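import Mathlib.MeasureTheory.Integral.IntervalIntegral.Basic
import Mathlib.Analysis.SpecialFunctions.Pow.Real
import Mathlib.Analysis.SpecificLimits.Basic
import HarnessLib

/-!
# Dyadic chaining of quadratic means: the weighted `ℓ³`-type sum `Σₙ 4ⁿ Aₙ^{3/2}`

Analysis/FluidPDE support file for the discharge of the named fact
`Literature.Analysis.FluidPDE.tao2011_nonlinearEstimate` (the nonlinear term `Y₆` in the proof
of Tao 2011, Thm. 10.1, arXiv:1108.1165 pp. 32–33). The step of the printed proof served here is
the control of "the second term of (y61), `c^{-0.1}δ² Σᵢ rᵢ⁴ wᵢ³`" by the parent-ball chaining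
argument (p. 33: "for any small ball `Bᵢ`, we may assign a 'parent' ball … `wᵢ ≤ w_{a(i)} +
Σₖ |w_{pᵏ(i)} - w_{pᵏ⁺¹(i)}|` … Taking cubes and using Hölder's inequality …"), transplanted
from Whitney balls to **dyadic radial shells**, where the chain is linear and the argument is
one-dimensional. Everything in this file is real analysis on an interval `(0, ℓ/4]` of the
distance variable `t`:

* `m ≥ 0` continuous (the spherical quadratic mean of a vorticity component at distance `t`),
  with the oscillation hypothesis `(m s' - m s)² ≤ (s' - s) ∫_{[s,s']} g²` (`g²` the spherical
  mean of `|∇ω|²`; Cauchy–Schwarz along rays, supplied by the caller);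
* dyadic blocks `Iₙ = [ℓ/2ⁿ⁺⁶, ℓ/2ⁿ⁺²]`, `Uₙ = [ℓ/2ⁿ⁺⁷, ℓ/2ⁿ⁺²] ⊇ Iₙ ∪ Iₙ₊₁`, weights
  `ℓ⁻¹ t q(t)` (`q` the spherical Jacobian, comparable to constants `Q⁻ₙ ≤ q ≤ Q⁺ₙ` on `Uₙ`),
  masses `Aₙ = ∫_{Iₙ} ℓ⁻¹ t q m²` (`= ∫_{shell} |ω|²η`), dissipations `Dₙ = ∫_{Uₙ} ℓ⁻¹ t q g²`;
* **conclusion** (`sum_four_pow_mul_rpow_le_of_chain`):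
  `Σ_{n ≤ N} 4ⁿ Aₙ^{3/2} ≤ C · Wtot^{1/2} · (Wtot + ℓ² Σ_{n ≤ N} Dₙ)` whenever `Aₙ ≤ Wtot`, with an
  absolute constant `C` (for the comparability constants `Q⁺ₙ ≤ 1024 Q⁻ₙ`, `Q⁻ₙ ≤ 1024 Q⁻ₙ₊₁`,
  `Q⁺ₙ ≤ 2 Q⁺ᵢ` (`i ≤ n`) that the spherical Jacobian satisfies on such blocks).

Ingredients: the quadratic means `M̄ₙ = (⨍_{Iₙ} m²)^{1/2}` satisfy `Aₙ ≍ ℓ 4⁻ⁿ Qₙ M̄ₙ²`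
(`4ⁿAₙ^{3/2} ≲ ℓ^{3/2} 2⁻ⁿ Qₙ^{3/2} M̄ₙ³`), the trivial bound `M̄ₙ ≲ 2ⁿ (Wtot/(ℓQₙ))^{1/2}` (Tao's
(10.22) "`wᵢ ≲ c^{0.05}δ⁻¹W^{1/2}rᵢ⁻²`"), the increment bound `|M̄ₙ₊₁ - M̄ₙ| ≤ oscₙ` with
`oscₙ² ≤ 32 ℓ Dₙ/Qₙ` (Tao's (10.23), Poincaré replaced by the fundamental theorem of calculus
along rays), the split `δ³ ≤ (M̄ₙ + M̄ₙ₊₁) δ²` ("(w-bong) once and (wij) twice"), and, in place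
of Tao's `(Σₖ xₖ)³ ≲ Σₖ (1+k)^{10} xₖ³`, the *geometric* Hölder chain
`(Σ_{i<n} δᵢ)³ ≤ 25 Σ_{i<n} (25/16)^{n-1-i} δᵢ³` proved by induction from the two-term inequality
`(X + y)³ ≤ (25/16) X³ + 25 y³` (`add_pow_three_le`).

## Mathlib / tree search

Pure real analysis; Mathlib: `MeasureTheory.setIntegral_mono_on`, `intervalIntegral`,
`hasSum_geometric_of_lt_one`, `sum_le_hasSum`, `Finset.sum_comm'`, `Finset.sum_Ico_eq_sum_range`.
`lean search 'chain.*cube|dyadic.*chain'`: nothing prior in the tree.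

## References

* T. Tao, *Localisation and compactness properties of the Navier–Stokes global regularity
  problem*, Anal. PDE 6 (2013) 25–107 = arXiv:1108.1165 (`Tao2011`), §10, proof of Thm. 10.1,
  p. 33 ((10.22)–(10.23) and the parent-ball chaining).
-/

noncomputable section

open MeasureTheory Set Filter Finset Real
open scoped BigOperators

namespace Literature.Analysis.FluidPDE

namespace DyadicChaining

/-! ### The geometric Hölder chain -/

/-- **Two-term weighted power-mean inequality:** `(X + y)³ ≤ (25/16) X³ + 25 y³` for
`X, y ≥ 0` (the case `(4/5) + (1/5) = 1` of `(a + b)³ ≤ (α^{-1/2} + β^{-1/2})² (αa³ + βb³)`;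
polynomially, `25X³ + 400y³ - 16(X+y)³ = (X - 4y)²(9X + 24y)`). [folklore] -/
theorem add_pow_three_le {X y : ℝ} (hX : 0 ≤ X) (hy : 0 ≤ y) :
    (X + y) ^ 3 ≤ 25 / 16 * X ^ 3 + 25 * y ^ 3 := by
  nlinarith [mul_nonneg (sq_nonneg (X - 4 * y)) (by positivity : (0 : ℝ) ≤ 9 * X + 24 * y)]

/-- The chain sums `cₙ = Σ_{i<n} (25/16)^{n-1-i} δᵢ³`, written without subtraction as
`(25/16)ⁿ Σ_{i<n} (16/25)^{i+1} δᵢ³`. [folklore] -/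
def chainSum (δ : ℕ → ℝ) (n : ℕ) : ℝ :=
  (25 / 16 : ℝ) ^ n * ∑ i ∈ range n, (16 / 25 : ℝ) ^ (i + 1) * δ i ^ 3

/-- `c₀ = 0`. [folklore] -/
theorem chainSum_zero (δ : ℕ → ℝ) : chainSum δ 0 = 0 := by simp [chainSum]

/-- The recursion `cₙ₊₁ = (25/16) cₙ + δₙ³`. [folklore] -/
theorem chainSum_succ (δ : ℕ → ℝ) (n : ℕ) :
    chainSum δ (n + 1) = 25 / 16 * chainSum δ n + δ n ^ 3 := by
  unfold chainSum
  rw [sum_range_succ, mul_add, show (25 / 16 : ℝ) ^ (n + 1) = (25 / 16 : ℝ) ^ n * (25 / 16) from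
    pow_succ _ _, show (16 / 25 : ℝ) ^ (n + 1) = (16 / 25 : ℝ) ^ n * (16 / 25) from pow_succ _ _]
  have h : (25 / 16 : ℝ) ^ n * (25 / 16) * ((16 / 25 : ℝ) ^ n * (16 / 25) * δ n ^ 3) = δ n ^ 3 := by
    have e : (25 / 16 : ℝ) ^ n * (16 / 25 : ℝ) ^ n = 1 := by
      rw [← mul_pow]; norm_num
    calc (25 / 16 : ℝ) ^ n * (25 / 16) * ((16 / 25 : ℝ) ^ n * (16 / 25) * δ n ^ 3)
        = ((25 / 16 : ℝ) ^ n * (16 / 25 : ℝ) ^ n) * ((25 / 16) * (16 / 25)) * δ n ^ 3 := by ring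
      _ = δ n ^ 3 := by rw [e]; norm_num
  rw [h]
  ring

/-- `cₙ ≥ 0` for `δ ≥ 0`. [folklore] -/
theorem chainSum_nonneg {δ : ℕ → ℝ} (hδ : ∀ i, 0 ≤ δ i) (n : ℕ) : 0 ≤ chainSum δ n :=
  mul_nonneg (by positivity) (sum_nonneg fun i _ => by have := hδ i; positivity)

/-- **The geometric Hölder chain:** `(Σ_{i<n} δᵢ)³ ≤ 25 cₙ` for `δ ≥ 0`, by induction from
`add_pow_three_le`. [folklore] -/
theorem sum_pow_three_le_chainSum {δ : ℕ → ℝ} (hδ : ∀ i, 0 ≤ δ i) (n : ℕ) :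
    (∑ i ∈ range n, δ i) ^ 3 ≤ 25 * chainSum δ n := by
  induction n with
  | zero => simp [chainSum]
  | succ n ih =>
    rw [sum_range_succ, chainSum_succ]
    have hS : 0 ≤ ∑ i ∈ range n, δ i := sum_nonneg fun i _ => hδ i
    calc (∑ i ∈ range n, δ i + δ n) ^ 3
        ≤ 25 / 16 * (∑ i ∈ range n, δ i) ^ 3 + 25 * δ n ^ 3 := add_pow_three_le hS (hδ n)
      _ ≤ 25 / 16 * (25 * chainSum δ n) + 25 * δ n ^ 3 := by gcongr
      _ = 25 * (25 / 16 * chainSum δ n + δ n ^ 3) := by ring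

/-- **Resummation of the chain sums against geometrically controlled weights.** If
`0 ≤ θₙ ≤ 2 θᵢ` for `i ≤ n`, then
`Σ_{n ≤ N} 2⁻ⁿ θₙ cₙ ≤ (16b/7) Σ_{i < N} 2⁻ⁱ θᵢ δᵢ³` (swap the sums; the inner sums are
geometric with ratio `25/32`); here with `0 ≤ θₙ ≤ b θᵢ`. [folklore] -/
theorem sum_weight_chainSum_le {δ θ : ℕ → ℝ} {b : ℝ} (hδ : ∀ i, 0 ≤ δ i) (hθ : ∀ n, 0 ≤ θ n)
    (hb : 0 ≤ b) (hθmono : ∀ i n, i ≤ n → θ n ≤ b * θ i) (N : ℕ) :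
    ∑ n ∈ range (N + 1), (2⁻¹ : ℝ) ^ n * θ n * chainSum δ n ≤
      16 * b / 7 * ∑ i ∈ range N, (2⁻¹ : ℝ) ^ i * θ i * δ i ^ 3 := by
  -- expand `cₙ` and swap the sums
  have hexp : ∀ n, (2⁻¹ : ℝ) ^ n * θ n * chainSum δ n =
      ∑ i ∈ range n, (2⁻¹ : ℝ) ^ n * θ n * ((25 / 16 : ℝ) ^ n * ((16 / 25 : ℝ) ^ (i + 1) * δ i ^ 3)) :=
    fun n => by rw [chainSum, mul_sum, mul_sum]
  simp_rw [hexp]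
  rw [sum_comm' (s' := fun i => Ico (i + 1) (N + 1)) (t' := range N)
    (h := fun n i => by
      simp only [Finset.mem_range, Finset.mem_Ico]
      omega)]
  rw [mul_sum]
  refine sum_le_sum fun i hi => ?_
  -- the inner sum over `n ∈ [i+1, N]`, reindexed by `n = i + 1 + m`
  rw [sum_Ico_eq_sum_range]
  have hterm : ∀ m : ℕ, (2⁻¹ : ℝ) ^ (i + 1 + m) * θ (i + 1 + m) *
      ((25 / 16 : ℝ) ^ (i + 1 + m) * ((16 / 25 : ℝ) ^ (i + 1) * δ i ^ 3)) ≤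
      (2⁻¹ : ℝ) ^ i * θ i * δ i ^ 3 * (b / 2) * ((25 / 32 : ℝ) ^ m) := by
    intro m
    have hθle : θ (i + 1 + m) ≤ b * θ i := hθmono i (i + 1 + m) (by omega)
    have hδ3 : 0 ≤ δ i ^ 3 := pow_nonneg (hδ i) 3
    have e : (2⁻¹ : ℝ) ^ (i + 1 + m) * ((25 / 16 : ℝ) ^ (i + 1 + m) * (16 / 25 : ℝ) ^ (i + 1)) =
        (2⁻¹ : ℝ) ^ i * 2⁻¹ * (25 / 32 : ℝ) ^ m := by
      rw [show (25 / 16 : ℝ) ^ (i + 1 + m) = (25 / 16 : ℝ) ^ (i + 1) * (25 / 16 : ℝ) ^ m from pow_add _ _ _,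
        show (2⁻¹ : ℝ) ^ (i + 1 + m) = (2⁻¹ : ℝ) ^ i * 2⁻¹ * (2⁻¹ : ℝ) ^ m by rw [pow_add, pow_succ],
        show (25 / 32 : ℝ) ^ m = (2⁻¹ : ℝ) ^ m * (25 / 16 : ℝ) ^ m by rw [← mul_pow]; norm_num]
      have e2 : (25 / 16 : ℝ) ^ (i + 1) * (16 / 25 : ℝ) ^ (i + 1) = 1 := by rw [← mul_pow]; norm_num
      calc (2⁻¹ : ℝ) ^ i * 2⁻¹ * (2⁻¹ : ℝ) ^ m * ((25 / 16 : ℝ) ^ (i + 1) * (25 / 16 : ℝ) ^ m * (16 / 25 : ℝ) ^ (i + 1))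
          = (2⁻¹ : ℝ) ^ i * 2⁻¹ * (2⁻¹ : ℝ) ^ m * (25 / 16 : ℝ) ^ m * ((25 / 16 : ℝ) ^ (i + 1) * (16 / 25 : ℝ) ^ (i + 1)) := by ring
        _ = (2⁻¹ : ℝ) ^ i * 2⁻¹ * ((2⁻¹ : ℝ) ^ m * (25 / 16 : ℝ) ^ m) := by rw [e2]; ring
    calc (2⁻¹ : ℝ) ^ (i + 1 + m) * θ (i + 1 + m) * ((25 / 16 : ℝ) ^ (i + 1 + m) * ((16 / 25 : ℝ) ^ (i + 1) * δ i ^ 3))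
        = ((2⁻¹ : ℝ) ^ (i + 1 + m) * ((25 / 16 : ℝ) ^ (i + 1 + m) * (16 / 25 : ℝ) ^ (i + 1))) * θ (i + 1 + m) * δ i ^ 3 := by ring
      _ = (2⁻¹ : ℝ) ^ i * 2⁻¹ * (25 / 32 : ℝ) ^ m * θ (i + 1 + m) * δ i ^ 3 := by rw [e]
      _ ≤ (2⁻¹ : ℝ) ^ i * 2⁻¹ * (25 / 32 : ℝ) ^ m * (b * θ i) * δ i ^ 3 := by gcongr
      _ = (2⁻¹ : ℝ) ^ i * θ i * δ i ^ 3 * (b / 2) * (25 / 32 : ℝ) ^ m := by ring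
  calc ∑ m ∈ range (N + 1 - (i + 1)), (2⁻¹ : ℝ) ^ (i + 1 + m) * θ (i + 1 + m) *
          ((25 / 16 : ℝ) ^ (i + 1 + m) * ((16 / 25 : ℝ) ^ (i + 1) * δ i ^ 3))
      ≤ ∑ m ∈ range (N + 1 - (i + 1)), (2⁻¹ : ℝ) ^ i * θ i * δ i ^ 3 * (b / 2) * (25 / 32 : ℝ) ^ m :=
        sum_le_sum fun m _ => hterm m
    _ = (2⁻¹ : ℝ) ^ i * θ i * δ i ^ 3 * (b / 2) * ∑ m ∈ range (N + 1 - (i + 1)), (25 / 32 : ℝ) ^ m := by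
        rw [mul_sum]
    _ ≤ (2⁻¹ : ℝ) ^ i * θ i * δ i ^ 3 * (b / 2) * (32 / 7) := by
        refine mul_le_mul_of_nonneg_left ?_ (by have := hθ i; have := hδ i; positivity)
        have hgeo := hasSum_geometric_of_lt_one (r := (25 / 32 : ℝ)) (by norm_num) (by norm_num)
        refine (sum_le_hasSum _ (fun m _ => by positivity) hgeo).trans (le_of_eq ?_)
        norm_num
    _ = 16 * b / 7 * ((2⁻¹ : ℝ) ^ i * θ i * δ i ^ 3) := by ring

/-! ### Quadratic means over intervals and their oscillation -/

/-- The quadratic mean `M̄_I = ((∫_I m²)/|I|)^{1/2}` of `m` over `I = [α, β]`. [folklore] -/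
def quadMean (m : ℝ → ℝ) (α β : ℝ) : ℝ :=
  Real.sqrt ((∫ t in Icc α β, m t ^ 2) / (β - α))

/-- `M̄ ≥ 0`. [folklore] -/
theorem quadMean_nonneg (m : ℝ → ℝ) (α β : ℝ) : 0 ≤ quadMean m α β := Real.sqrt_nonneg _

/-- `M̄² = (∫_I m²)/|I|` for `α < β`. [folklore] -/
theorem quadMean_sq (m : ℝ → ℝ) {α β : ℝ} (hαβ : α < β) :
    quadMean m α β ^ 2 = (∫ t in Icc α β, m t ^ 2) / (β - α) :=
  Real.sq_sqrt (div_nonneg (integral_nonneg fun t => sq_nonneg _) (by linarith))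

/-- **Upper comparison:** if `m s ≤ B` for all `s ∈ [α, β]` (`B ≥ 0`, `m ≥ 0` there, `m²`
integrable), then `M̄ ≤ B`. [folklore] -/
theorem quadMean_le_of_le {m : ℝ → ℝ} {α β B : ℝ} (hαβ : α < β) (hB : 0 ≤ B)
    (hm0 : ∀ s ∈ Icc α β, 0 ≤ m s) (hint : IntegrableOn (fun t => m t ^ 2) (Icc α β))
    (hle : ∀ s ∈ Icc α β, m s ≤ B) : quadMean m α β ≤ B := by
  have h1 : ∫ t in Icc α β, m t ^ 2 ≤ ∫ t in Icc α β, B ^ 2 := by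
    refine setIntegral_mono_on hint (integrableOn_const (by
      rw [Real.volume_Icc]; exact ENNReal.ofReal_ne_top)) measurableSet_Icc fun s hs => ?_
    exact pow_le_pow_left₀ (hm0 s hs) (hle s hs) 2
  rw [setIntegral_const, Real.volume_real_Icc_of_le hαβ.le, smul_eq_mul] at h1
  have h2 : (∫ t in Icc α β, m t ^ 2) / (β - α) ≤ B ^ 2 := by
    rw [div_le_iff₀ (by linarith)]; linarith
  calc quadMean m α β = Real.sqrt ((∫ t in Icc α β, m t ^ 2) / (β - α)) := rfl
    _ ≤ Real.sqrt (B ^ 2) := Real.sqrt_le_sqrt h2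
    _ = B := Real.sqrt_sq hB

/-- **Lower comparison:** if `B ≤ m s` for all `s ∈ [α, β]` (`B ≥ 0`, `m²` integrable), then
`B ≤ M̄`. [folklore] -/
theorem le_quadMean_of_le {m : ℝ → ℝ} {α β B : ℝ} (hαβ : α < β) (hB : 0 ≤ B)
    (hint : IntegrableOn (fun t => m t ^ 2) (Icc α β)) (hle : ∀ s ∈ Icc α β, B ≤ m s) :
    B ≤ quadMean m α β := by
  have h1 : ∫ t in Icc α β, B ^ 2 ≤ ∫ t in Icc α β, m t ^ 2 := by
    refine setIntegral_mono_on (integrableOn_const (by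
      rw [Real.volume_Icc]; exact ENNReal.ofReal_ne_top)) hint measurableSet_Icc fun s hs => ?_
    exact pow_le_pow_left₀ hB (hle s hs) 2
  rw [setIntegral_const, Real.volume_real_Icc_of_le hαβ.le, smul_eq_mul] at h1
  have h2 : B ^ 2 ≤ (∫ t in Icc α β, m t ^ 2) / (β - α) := by
    rw [le_div_iff₀ (by linarith)]; linarith
  calc B = Real.sqrt (B ^ 2) := (Real.sqrt_sq hB).symm
    _ ≤ Real.sqrt ((∫ t in Icc α β, m t ^ 2) / (β - α)) := Real.sqrt_le_sqrt h2

/-- **Oscillation of quadratic means:** if `|m s - m t| ≤ osc` for all `s, t` in a set `U`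
containing both intervals `[α, β]` and `[α', β']` (on which `m ≥ 0` with `m²` integrable),
then `|M̄_{[α,β]} - M̄_{[α',β']}| ≤ osc`. [folklore] -/
theorem abs_quadMean_sub_quadMean_le {m : ℝ → ℝ} {α β α' β' osc : ℝ} {U : Set ℝ}
    (hαβ : α < β) (hαβ' : α' < β') (hI : Icc α β ⊆ U) (hI' : Icc α' β' ⊆ U)
    (hm0 : ∀ s ∈ U, 0 ≤ m s) (hint : IntegrableOn (fun t => m t ^ 2) (Icc α β))
    (hint' : IntegrableOn (fun t => m t ^ 2) (Icc α' β'))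
    (hosc : ∀ s ∈ U, ∀ t ∈ U, |m s - m t| ≤ osc) :
    |quadMean m α β - quadMean m α' β'| ≤ osc := by
  have hosc0 : 0 ≤ osc := (abs_nonneg _).trans (hosc α (hI (left_mem_Icc.2 hαβ.le)) α
    (hI (left_mem_Icc.2 hαβ.le)))
  -- one-sided bound, abstractly
  have key : ∀ {a b a' b' : ℝ}, a < b → a' < b' → Icc a b ⊆ U → Icc a' b' ⊆ U →
      IntegrableOn (fun t => m t ^ 2) (Icc a b) → IntegrableOn (fun t => m t ^ 2) (Icc a' b') →
      quadMean m a b - osc ≤ quadMean m a' b' := by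
    intro a b a' b' hab hab' hJ hJ' hi hi'
    -- for every `t ∈ [a', b']`: `M̄_{[a,b]} ≤ m t + osc`
    have h1 : ∀ t ∈ Icc a' b', quadMean m a b ≤ m t + osc := fun t ht =>
      quadMean_le_of_le hab (by linarith [hm0 t (hJ' ht)]) (fun s hs => hm0 s (hJ hs)) hi
        fun s hs => by linarith [abs_le.1 (hosc s (hJ hs) t (hJ' ht))]
    by_cases hneg : quadMean m a b - osc ≤ 0
    · exact hneg.trans (quadMean_nonneg _ _ _)
    · exact le_quadMean_of_le hab' (by linarith [not_le.1 hneg]) hi' fun t ht => by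
        linarith [h1 t ht]
  rw [abs_le]
  constructor
  · linarith [key hαβ' hαβ hI' hI hint' hint]
  · linarith [key hαβ hαβ' hI hI' hint hint']

/-! ### The dyadic blocks and the hypotheses of the chaining argument -/

/-- Left endpoint `ℓ/2ⁿ⁺⁶` of the block `Iₙ`. [folklore] -/
def tlo (ℓ : ℝ) (n : ℕ) : ℝ := ℓ / 2 ^ (n + 6)

/-- Right endpoint `ℓ/2ⁿ⁺²` of the blocks `Iₙ` and `Uₙ`. [folklore] -/
def thi (ℓ : ℝ) (n : ℕ) : ℝ := ℓ / 2 ^ (n + 2)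

/-- Left endpoint `ℓ/2ⁿ⁺⁷` of the enlarged block `Uₙ ⊇ Iₙ ∪ Iₙ₊₁`. [folklore] -/
def ulo (ℓ : ℝ) (n : ℕ) : ℝ := ℓ / 2 ^ (n + 7)

/-- The mass `Aₙ = ∫_{Iₙ} ℓ⁻¹ t q(t) m(t)² dt` of the block `Iₙ` (the shell integral
`∫_{S̃ⱼ} |ω|² η` in polar coordinates). [folklore] -/
def mass (ℓ : ℝ) (m q : ℝ → ℝ) (n : ℕ) : ℝ :=
  ∫ t in Icc (tlo ℓ n) (thi ℓ n), ℓ⁻¹ * t * q t * m t ^ 2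

/-- The dissipation `Dₙ = ∫_{Uₙ} ℓ⁻¹ t q(t) g(t)² dt` of the enlarged block (the shell integral
`∫ |∇ω|² η`). [folklore] -/
def diss (ℓ : ℝ) (g q : ℝ → ℝ) (n : ℕ) : ℝ :=
  ∫ t in Icc (ulo ℓ n) (thi ℓ n), ℓ⁻¹ * t * q t * g t ^ 2

/-- The quadratic mean `M̄ₙ` of `m` over `Iₙ`. [folklore] -/
def bmean (ℓ : ℝ) (m : ℝ → ℝ) (n : ℕ) : ℝ := quadMean m (tlo ℓ n) (thi ℓ n)

/-- **Hypotheses of the dyadic chaining argument** on the distance interval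
`[ℓ/2ᴺ⁺⁷, ℓ/4]`: `m ≥ 0` and `q` continuous, `g²` integrable, the Jacobian `q` pinched between
`Q⁻ₙ ≤ q ≤ Q⁺ₙ` on each `Uₙ` with `Q⁺ₙ ≤ 1024 Q⁻ₙ`, `Q⁻ₙ ≤ 4 Q⁻ₙ₊₁`, `Q⁺ₙ ≤ 2 Q⁺ᵢ` (`i ≤ n`),
the ray oscillation hypothesis `(m s' - m s)² ≤ (s' - s) ∫_{[s,s']} g²`, and the mass bound
`Aₙ ≤ Wtot`. [folklore] -/
structure ChainHyp (ℓ : ℝ) (N : ℕ) (m g q : ℝ → ℝ) (Qlo Qhi : ℕ → ℝ) (Wtot : ℝ) : Prop where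
  hℓ : 0 < ℓ
  hm0 : ∀ t ∈ Icc (ℓ / 2 ^ (N + 7)) (ℓ / 4), 0 ≤ m t
  hmc : ContinuousOn m (Icc (ℓ / 2 ^ (N + 7)) (ℓ / 4))
  hqc : ContinuousOn q (Icc (ℓ / 2 ^ (N + 7)) (ℓ / 4))
  hg : IntegrableOn (fun t => g t ^ 2) (Icc (ℓ / 2 ^ (N + 7)) (ℓ / 4))
  hQlo : ∀ n, 0 < Qlo n
  hq : ∀ n ≤ N, ∀ t ∈ Icc (ulo ℓ n) (thi ℓ n), Qlo n ≤ q t ∧ q t ≤ Qhi n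
  hΛ : ∀ n, Qhi n ≤ 1024 * Qlo n
  hΛ' : ∀ n, Qlo n ≤ 4 * Qlo (n + 1)
  hβ : ∀ i n, i ≤ n → Qhi n ≤ 2 * Qhi i
  hosc : ∀ s ∈ Icc (ℓ / 2 ^ (N + 7)) (ℓ / 4), ∀ s' ∈ Icc (ℓ / 2 ^ (N + 7)) (ℓ / 4), s ≤ s' →
    (m s' - m s) ^ 2 ≤ (s' - s) * ∫ τ in Icc s s', g τ ^ 2
  hW : ∀ n ≤ N, mass ℓ m q n ≤ Wtot

section Chain

variable {ℓ : ℝ} {N : ℕ} {m g q : ℝ → ℝ} {Qlo Qhi : ℕ → ℝ} {Wtot : ℝ}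

/-! #### Elementary facts about the blocks -/

/-- `ℓ/2ᵏ ≤ ℓ/2ʲ` for `j ≤ k`. [folklore] -/
theorem div_two_pow_anti {ℓ : ℝ} (hℓ : 0 ≤ ℓ) {j k : ℕ} (h : j ≤ k) : ℓ / 2 ^ k ≤ ℓ / 2 ^ j :=
  div_le_div_of_nonneg_left hℓ (by positivity) (pow_le_pow_right₀ (by norm_num) h)

/-- `ℓ/2ᵏ⁺¹ = (ℓ/2ᵏ)/2`. [folklore] -/
theorem div_two_pow_succ (ℓ : ℝ) (k : ℕ) : ℓ / 2 ^ (k + 1) = ℓ / 2 ^ k / 2 := by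
  rw [pow_succ, div_div]

/-- `ulo < tlo`. [folklore] -/
theorem ulo_lt_tlo (hℓ : 0 < ℓ) (n : ℕ) : ulo ℓ n < tlo ℓ n := by
  unfold ulo tlo
  exact div_lt_div_of_pos_left hℓ (by positivity) (pow_lt_pow_right₀ (by norm_num) (by omega))

/-- `tlo < thi`. [folklore] -/
theorem tlo_lt_thi (hℓ : 0 < ℓ) (n : ℕ) : tlo ℓ n < thi ℓ n := by
  unfold tlo thi
  exact div_lt_div_of_pos_left hℓ (by positivity) (pow_lt_pow_right₀ (by norm_num) (by omega))

/-- `ulo < thi`. [folklore] -/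
theorem ulo_lt_thi (hℓ : 0 < ℓ) (n : ℕ) : ulo ℓ n < thi ℓ n :=
  (ulo_lt_tlo hℓ n).trans (tlo_lt_thi hℓ n)

/-- `0 < tlo`. [folklore] -/
theorem tlo_pos (hℓ : 0 < ℓ) (n : ℕ) : 0 < tlo ℓ n := by unfold tlo; positivity

/-- `0 < ulo`. [folklore] -/
theorem ulo_pos (hℓ : 0 < ℓ) (n : ℕ) : 0 < ulo ℓ n := by unfold ulo; positivity

/-- `Uₙ ⊆ [ℓ/2ᴺ⁺⁷, ℓ/4]` for `n ≤ N`. [folklore] -/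
theorem U_subset (hℓ : 0 < ℓ) {n : ℕ} (hn : n ≤ N) :
    Icc (ulo ℓ n) (thi ℓ n) ⊆ Icc (ℓ / 2 ^ (N + 7)) (ℓ / 4) := by
  refine Icc_subset_Icc ?_ ?_
  · exact div_two_pow_anti hℓ.le (by omega)
  · unfold thi
    calc ℓ / 2 ^ (n + 2) ≤ ℓ / 2 ^ 2 := div_two_pow_anti hℓ.le (by omega)
      _ = ℓ / 4 := by norm_num

/-- `Iₙ ⊆ Uₙ`. [folklore] -/
theorem I_subset_U (hℓ : 0 < ℓ) (n : ℕ) : Icc (tlo ℓ n) (thi ℓ n) ⊆ Icc (ulo ℓ n) (thi ℓ n) :=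
  Icc_subset_Icc (ulo_lt_tlo hℓ n).le le_rfl

/-- `Iₙ₊₁ ⊆ Uₙ`. [folklore] -/
theorem I_succ_subset_U (hℓ : 0 < ℓ) (n : ℕ) :
    Icc (tlo ℓ (n + 1)) (thi ℓ (n + 1)) ⊆ Icc (ulo ℓ n) (thi ℓ n) := by
  refine Icc_subset_Icc (le_of_eq ?_) ?_
  · unfold ulo tlo; ring_nf
  · unfold thi; exact div_two_pow_anti hℓ.le (by omega)

/-- `|Iₙ| ≥ ℓ/2ⁿ⁺⁴`. [folklore] -/
theorem length_I_ge (hℓ : 0 < ℓ) (n : ℕ) : ℓ / 2 ^ (n + 4) ≤ thi ℓ n - tlo ℓ n := by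
  unfold thi tlo
  have e4 : ℓ / 2 ^ (n + 4) = ℓ / 2 ^ (n + 2) / 4 := by
    rw [div_div]; ring
  have e6 : ℓ / 2 ^ (n + 6) = ℓ / 2 ^ (n + 2) / 16 := by
    rw [div_div]; ring
  rw [e4, e6]
  have : 0 < ℓ / 2 ^ (n + 2) := by positivity
  linarith

/-- `|Iₙ| ≤ ℓ/2ⁿ⁺²`. [folklore] -/
theorem length_I_le (hℓ : 0 < ℓ) (n : ℕ) : thi ℓ n - tlo ℓ n ≤ ℓ / 2 ^ (n + 2) := by
  unfold thi; linarith [tlo_pos hℓ n]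

/-- `|Uₙ| ≤ ℓ/2ⁿ⁺¹`. [folklore] -/
theorem length_U_le (hℓ : 0 < ℓ) (n : ℕ) : thi ℓ n - ulo ℓ n ≤ ℓ / 2 ^ (n + 1) := by
  unfold thi
  have h1 : ℓ / 2 ^ (n + 2) ≤ ℓ / 2 ^ (n + 1) := div_two_pow_anti hℓ.le (by omega)
  linarith [ulo_pos hℓ n]

/-- `ℓ⁻¹ · tlo = 2⁻⁽ⁿ⁺⁶⁾`, `ℓ⁻¹ · thi = 2⁻⁽ⁿ⁺²⁾`, `ℓ⁻¹ · ulo = 2⁻⁽ⁿ⁺⁷⁾`. [folklore] -/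
theorem inv_mul_tlo (hℓ : 0 < ℓ) (n : ℕ) : ℓ⁻¹ * tlo ℓ n = (2 ^ (n + 6))⁻¹ := by
  unfold tlo; field_simp

/-- `ℓ⁻¹ · thi = 2⁻⁽ⁿ⁺²⁾`. [folklore] -/
theorem inv_mul_thi (hℓ : 0 < ℓ) (n : ℕ) : ℓ⁻¹ * thi ℓ n = (2 ^ (n + 2))⁻¹ := by
  unfold thi; field_simp

/-- `ℓ⁻¹ · ulo = 2⁻⁽ⁿ⁺⁷⁾`. [folklore] -/
theorem inv_mul_ulo (hℓ : 0 < ℓ) (n : ℕ) : ℓ⁻¹ * ulo ℓ n = (2 ^ (n + 7))⁻¹ := by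
  unfold ulo; field_simp

/-! #### Integrability on the blocks -/

/-- `m²` is integrable on sub-intervals of the distance interval. [folklore] -/
theorem ChainHyp.integrableOn_m_sq (h : ChainHyp ℓ N m g q Qlo Qhi Wtot) {a b : ℝ}
    (hab : Icc a b ⊆ Icc (ℓ / 2 ^ (N + 7)) (ℓ / 4)) : IntegrableOn (fun t => m t ^ 2) (Icc a b) :=
  ((h.hmc.mono hab).pow 2).integrableOn_compact isCompact_Icc

/-- The mass integrand is integrable on sub-intervals. [folklore] -/
theorem ChainHyp.integrableOn_weight_m_sq (h : ChainHyp ℓ N m g q Qlo Qhi Wtot) {a b : ℝ}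
    (hab : Icc a b ⊆ Icc (ℓ / 2 ^ (N + 7)) (ℓ / 4)) :
    IntegrableOn (fun t => ℓ⁻¹ * t * q t * m t ^ 2) (Icc a b) := by
  have hc : ContinuousOn (fun t => ℓ⁻¹ * t * q t * m t ^ 2) (Icc a b) :=
    ((continuousOn_const.mul continuousOn_id).mul (h.hqc.mono hab)).mul ((h.hmc.mono hab).pow 2)
  exact hc.integrableOn_compact isCompact_Icc

/-- `g²` is integrable on sub-intervals. [folklore] -/
theorem ChainHyp.integrableOn_g_sq (h : ChainHyp ℓ N m g q Qlo Qhi Wtot) {a b : ℝ}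
    (hab : Icc a b ⊆ Icc (ℓ / 2 ^ (N + 7)) (ℓ / 4)) : IntegrableOn (fun t => g t ^ 2) (Icc a b) :=
  h.hg.mono_set hab

/-- The dissipation integrand is integrable on sub-intervals. [folklore] -/
theorem ChainHyp.integrableOn_weight_g_sq (h : ChainHyp ℓ N m g q Qlo Qhi Wtot) {a b : ℝ}
    (hab : Icc a b ⊆ Icc (ℓ / 2 ^ (N + 7)) (ℓ / 4)) :
    IntegrableOn (fun t => ℓ⁻¹ * t * q t * g t ^ 2) (Icc a b) := by
  have hc : ContinuousOn (fun t => ℓ⁻¹ * t * q t) (Icc a b) :=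
    (continuousOn_const.mul continuousOn_id).mul (h.hqc.mono hab)
  exact (h.integrableOn_g_sq hab).continuousOn_mul hc isCompact_Icc

/-! #### The trivial mass bound for the quadratic means ((10.22)) -/

/-- **`√ℓ √Q⁻ₙ M̄ₙ ≤ 2ⁿ⁺⁵ √Wtot`** (Tao's "`wᵢ ≲ c^{0.05}δ⁻¹W^{1/2}rᵢ⁻²`": the mass of one block is
at most the total mass). [cite: Tao2011, §10, proof of Thm. 10.1 ((10.22))] -/
theorem ChainHyp.bmean_le (h : ChainHyp ℓ N m g q Qlo Qhi Wtot) {n : ℕ} (hn : n ≤ N) :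
    Real.sqrt ℓ * Real.sqrt (Qlo n) * bmean ℓ m n ≤ 2 ^ (n + 5) * Real.sqrt Wtot := by
  have hℓ := h.hℓ
  have hIU := I_subset_U hℓ n
  have hIdom := hIU.trans (U_subset hℓ hn)
  have hlt := tlo_lt_thi hℓ n
  have hQ := h.hQlo n
  -- `2⁻⁽ⁿ⁺⁶⁾ Q⁻ ∫_{Iₙ} m² ≤ Aₙ ≤ Wtot`
  have h1 : (2 ^ (n + 6))⁻¹ * Qlo n * ∫ t in Icc (tlo ℓ n) (thi ℓ n), m t ^ 2 ≤ mass ℓ m q n := by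
    rw [← integral_const_mul]
    refine setIntegral_mono_on ((h.integrableOn_m_sq hIdom).const_mul _)
      (h.integrableOn_weight_m_sq hIdom) measurableSet_Icc fun t ht => ?_
    have hqt := (h.hq n hn t (hIU ht)).1
    have htlo : (2 ^ (n + 6))⁻¹ ≤ ℓ⁻¹ * t := by
      rw [← inv_mul_tlo hℓ n]
      exact mul_le_mul_of_nonneg_left ht.1 (inv_nonneg.2 hℓ.le)
    have hm2 : 0 ≤ m t ^ 2 := sq_nonneg _
    calc (2 ^ (n + 6))⁻¹ * Qlo n * m t ^ 2 ≤ ℓ⁻¹ * t * Qlo n * m t ^ 2 := by gcongr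
      _ ≤ ℓ⁻¹ * t * q t * m t ^ 2 := by
          gcongr
          exact mul_nonneg (inv_nonneg.2 hℓ.le) ((tlo_pos hℓ n).le.trans ht.1)
  have hW : mass ℓ m q n ≤ Wtot := h.hW n hn
  have hW0 : 0 ≤ Wtot := le_trans (le_trans (by
    have : 0 ≤ ∫ t in Icc (tlo ℓ n) (thi ℓ n), m t ^ 2 := integral_nonneg fun t => sq_nonneg _
    positivity) h1) hW
  -- `M̄² = (∫ m²)/|I|`, `|I| ≥ ℓ/2ⁿ⁺⁴`
  have hM2 := quadMean_sq m hlt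
  have hlen := length_I_ge hℓ n
  have hlenpos : 0 < thi ℓ n - tlo ℓ n := by linarith
  have hint0 : 0 ≤ ∫ t in Icc (tlo ℓ n) (thi ℓ n), m t ^ 2 := integral_nonneg fun t => sq_nonneg _
  -- `ℓ Q⁻ M̄² ≤ 4ⁿ⁺⁵ Wtot`
  have hkey : ℓ * Qlo n * bmean ℓ m n ^ 2 ≤ (2 ^ (n + 5)) ^ 2 * Wtot := by
    unfold bmean
    rw [hM2]
    have e1 : ∫ t in Icc (tlo ℓ n) (thi ℓ n), m t ^ 2 ≤ 2 ^ (n + 6) * Wtot / Qlo n := by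
      rw [le_div_iff₀ hQ]
      have := h1.trans hW
      have e : (2 ^ (n + 6))⁻¹ * Qlo n * (∫ t in Icc (tlo ℓ n) (thi ℓ n), m t ^ 2) * 2 ^ (n + 6) =
          (∫ t in Icc (tlo ℓ n) (thi ℓ n), m t ^ 2) * Qlo n := by field_simp
      nlinarith [e, this, pow_pos (two_pos (α := ℝ)) (n + 6)]
    have e2 : (∫ t in Icc (tlo ℓ n) (thi ℓ n), m t ^ 2) / (thi ℓ n - tlo ℓ n) ≤
        (2 ^ (n + 6) * Wtot / Qlo n) / (ℓ / 2 ^ (n + 4)) :=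
      div_le_div₀ (by positivity) e1 (by positivity) hlen
    calc ℓ * Qlo n * ((∫ t in Icc (tlo ℓ n) (thi ℓ n), m t ^ 2) / (thi ℓ n - tlo ℓ n))
        ≤ ℓ * Qlo n * ((2 ^ (n + 6) * Wtot / Qlo n) / (ℓ / 2 ^ (n + 4))) := by gcongr
      _ = (2 ^ (n + 5)) ^ 2 * Wtot := by
          field_simp
          ring
  have hlhs : (Real.sqrt ℓ * Real.sqrt (Qlo n) * bmean ℓ m n) ^ 2 = ℓ * Qlo n * bmean ℓ m n ^ 2 := by
    rw [mul_pow, mul_pow, Real.sq_sqrt hℓ.le, Real.sq_sqrt hQ.le]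
  have hrhs : (2 ^ (n + 5) * Real.sqrt Wtot) ^ 2 = (2 ^ (n + 5)) ^ 2 * Wtot := by
    rw [mul_pow, Real.sq_sqrt hW0]
  exact (pow_le_pow_iff_left₀ (by positivity [quadMean_nonneg m (tlo ℓ n) (thi ℓ n)])
    (by positivity) two_ne_zero).1 (by rw [hlhs, hrhs]; exact hkey)

/-! #### The block mass in terms of the quadratic mean -/

/-- **`64 · 2ⁿ · (4ⁿ Aₙ √Aₙ) ≤ (√ℓ)³ (√Q⁺ₙ)³ M̄ₙ³`**: on `Iₙ` the weight is at most
`2⁻⁽ⁿ⁺²⁾ Q⁺ₙ` and `∫_{Iₙ} m² = |Iₙ| M̄ₙ² ≤ (ℓ/2ⁿ⁺²) M̄ₙ²`. [folklore] -/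
theorem ChainHyp.mass_rpow_le (h : ChainHyp ℓ N m g q Qlo Qhi Wtot) {n : ℕ} (hn : n ≤ N) :
    64 * 2 ^ n * (4 ^ n * (mass ℓ m q n * Real.sqrt (mass ℓ m q n))) ≤
      Real.sqrt ℓ ^ 3 * Real.sqrt (Qhi n) ^ 3 * bmean ℓ m n ^ 3 := by
  have hℓ := h.hℓ
  have hIU := I_subset_U hℓ n
  have hIdom := hIU.trans (U_subset hℓ hn)
  have hlt := tlo_lt_thi hℓ n
  have hQlo := h.hQlo n
  have hQhi : 0 < Qhi n := hQlo.trans_le ((h.hq n hn (tlo ℓ n) (hIU (left_mem_Icc.2 hlt.le))).1.trans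
    (h.hq n hn (tlo ℓ n) (hIU (left_mem_Icc.2 hlt.le))).2)
  set J := ∫ t in Icc (tlo ℓ n) (thi ℓ n), m t ^ 2 with hJ
  have hJ0 : 0 ≤ J := integral_nonneg fun t => sq_nonneg _
  set M := bmean ℓ m n with hM
  have hM0 : 0 ≤ M := quadMean_nonneg _ _ _
  -- `Aₙ ≤ 2⁻⁽ⁿ⁺²⁾ Q⁺ J`
  have h1 : mass ℓ m q n ≤ (2 ^ (n + 2))⁻¹ * Qhi n * J := by
    rw [hJ, ← integral_const_mul]
    refine setIntegral_mono_on (h.integrableOn_weight_m_sq hIdom)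
      ((h.integrableOn_m_sq hIdom).const_mul _) measurableSet_Icc fun t ht => ?_
    have hqt := (h.hq n hn t (hIU ht)).2
    have hthi : ℓ⁻¹ * t ≤ (2 ^ (n + 2))⁻¹ := by
      rw [← inv_mul_thi hℓ n]
      exact mul_le_mul_of_nonneg_left ht.2 (inv_nonneg.2 hℓ.le)
    have ht0 : 0 ≤ ℓ⁻¹ * t := mul_nonneg (inv_nonneg.2 hℓ.le) ((tlo_pos hℓ n).le.trans ht.1)
    have hq0 : 0 ≤ q t := hQlo.le.trans (h.hq n hn t (hIU ht)).1
    have hm2 : 0 ≤ m t ^ 2 := sq_nonneg _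
    calc ℓ⁻¹ * t * q t * m t ^ 2 ≤ (2 ^ (n + 2))⁻¹ * q t * m t ^ 2 := by gcongr
      _ ≤ (2 ^ (n + 2))⁻¹ * Qhi n * m t ^ 2 := by gcongr
  -- `J = |I| M² ≤ (ℓ/2ⁿ⁺²) M²`
  have h2 : J ≤ ℓ / 2 ^ (n + 2) * M ^ 2 := by
    have hM2 := quadMean_sq m hlt
    have hlenpos : 0 < thi ℓ n - tlo ℓ n := by linarith
    have e : J = (thi ℓ n - tlo ℓ n) * M ^ 2 := by
      rw [hM, bmean, hM2, hJ]
      field_simp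
    rw [e]
    exact mul_le_mul_of_nonneg_right (length_I_le hℓ n) (sq_nonneg _)
  -- `Aₙ ≤ κ M²`, `κ = ℓ Q⁺/4ⁿ⁺² = (√ℓ √Q⁺/2ⁿ⁺²)²`
  set κ : ℝ := ℓ * Qhi n / 4 ^ (n + 2) with hκ
  have hκ' : κ = (Real.sqrt ℓ * Real.sqrt (Qhi n) / 2 ^ (n + 2)) ^ 2 := by
    rw [div_pow, mul_pow, Real.sq_sqrt hℓ.le, Real.sq_sqrt hQhi.le, ← pow_mul,
      show (2 : ℝ) ^ ((n + 2) * 2) = 4 ^ (n + 2) by rw [pow_mul']; norm_num]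
  have hA : mass ℓ m q n ≤ κ * M ^ 2 := by
    calc mass ℓ m q n ≤ (2 ^ (n + 2))⁻¹ * Qhi n * J := h1
      _ ≤ (2 ^ (n + 2))⁻¹ * Qhi n * (ℓ / 2 ^ (n + 2) * M ^ 2) := by gcongr
      _ = κ * M ^ 2 := by
          rw [hκ, show (4 : ℝ) ^ (n + 2) = 2 ^ (n + 2) * 2 ^ (n + 2) by rw [← mul_pow]; norm_num]
          field_simp
  have hA0 : 0 ≤ mass ℓ m q n := by
    refine setIntegral_nonneg measurableSet_Icc fun t ht => ?_
    have ht0 : 0 ≤ ℓ⁻¹ * t := mul_nonneg (inv_nonneg.2 hℓ.le) ((tlo_pos hℓ n).le.trans ht.1)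
    have hq0 : 0 ≤ q t := hQlo.le.trans (h.hq n hn t (hIU ht)).1
    positivity
  have hsqrtA : Real.sqrt (mass ℓ m q n) ≤ Real.sqrt ℓ * Real.sqrt (Qhi n) / 2 ^ (n + 2) * M := by
    calc Real.sqrt (mass ℓ m q n) ≤ Real.sqrt (κ * M ^ 2) := Real.sqrt_le_sqrt hA
      _ = Real.sqrt ℓ * Real.sqrt (Qhi n) / 2 ^ (n + 2) * M := by
          rw [hκ', ← mul_pow, Real.sqrt_sq (by positivity)]
  calc 64 * 2 ^ n * (4 ^ n * (mass ℓ m q n * Real.sqrt (mass ℓ m q n)))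
      ≤ 64 * 2 ^ n * (4 ^ n * ((κ * M ^ 2) * (Real.sqrt ℓ * Real.sqrt (Qhi n) / 2 ^ (n + 2) * M))) := by
        gcongr
    _ = Real.sqrt ℓ ^ 3 * Real.sqrt (Qhi n) ^ 3 * M ^ 3 := by
        rw [hκ']
        have e2 : (2 : ℝ) ^ (n + 2) = 2 ^ n * 4 := by rw [pow_add]; norm_num
        have e4 : (4 : ℝ) ^ n = 2 ^ n * 2 ^ n := by rw [← mul_pow]; norm_num
        rw [e2, e4]
        field_simp
        ring

/-! #### Oscillation on the enlarged blocks ((10.23)) -/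

/-- **`√Q⁻ₙ |m s - m t| ≤ 8 √ℓ √Dₙ`** for `s, t ∈ Uₙ` (Tao's (10.23) `|wᵢ - wⱼ| ≲ rᵢ^{-1/2}(∫_{10Bᵢ}|∇ω|²)^{1/2}`,
the Poincaré inequality replaced by the ray oscillation hypothesis). [cite: Tao2011, §10, proof of Thm. 10.1 ((10.23))] -/
theorem ChainHyp.osc_le (h : ChainHyp ℓ N m g q Qlo Qhi Wtot) {n : ℕ} (hn : n ≤ N)
    {s t : ℝ} (hs : s ∈ Icc (ulo ℓ n) (thi ℓ n)) (ht : t ∈ Icc (ulo ℓ n) (thi ℓ n)) :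
    Real.sqrt (Qlo n) * |m s - m t| ≤ 8 * Real.sqrt ℓ * Real.sqrt (diss ℓ g q n) := by
  have hℓ := h.hℓ
  have hUdom := U_subset hℓ hn
  have hQlo := h.hQlo n
  -- `∫_{Uₙ} g² ≤ 2ⁿ⁺⁷ Dₙ / Q⁻ₙ`
  set G := ∫ τ in Icc (ulo ℓ n) (thi ℓ n), g τ ^ 2 with hG
  have hG0 : 0 ≤ G := integral_nonneg fun t => sq_nonneg _
  have hD : (2 ^ (n + 7))⁻¹ * Qlo n * G ≤ diss ℓ g q n := by
    rw [hG, ← integral_const_mul]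
    refine setIntegral_mono_on ((h.integrableOn_g_sq hUdom).const_mul _)
      (h.integrableOn_weight_g_sq hUdom) measurableSet_Icc fun τ hτ => ?_
    have hqt := (h.hq n hn τ hτ).1
    have hulo : (2 ^ (n + 7))⁻¹ ≤ ℓ⁻¹ * τ := by
      rw [← inv_mul_ulo hℓ n]
      exact mul_le_mul_of_nonneg_left hτ.1 (inv_nonneg.2 hℓ.le)
    have hg2 : 0 ≤ g τ ^ 2 := sq_nonneg _
    calc (2 ^ (n + 7))⁻¹ * Qlo n * g τ ^ 2 ≤ ℓ⁻¹ * τ * Qlo n * g τ ^ 2 := by gcongr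
      _ ≤ ℓ⁻¹ * τ * q τ * g τ ^ 2 := by
          gcongr
          exact mul_nonneg (inv_nonneg.2 hℓ.le) ((ulo_pos hℓ n).le.trans hτ.1)
  have hD0 : 0 ≤ diss ℓ g q n := le_trans (by positivity) hD
  -- the oscillation for ordered pairs
  have key : ∀ {a b : ℝ}, a ∈ Icc (ulo ℓ n) (thi ℓ n) → b ∈ Icc (ulo ℓ n) (thi ℓ n) → a ≤ b →
      Qlo n * (m b - m a) ^ 2 ≤ 64 * ℓ * diss ℓ g q n := by
    intro a b ha hb hab
    have h1 := h.hosc a (hUdom ha) b (hUdom hb) hab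
    have h2 : ∫ τ in Icc a b, g τ ^ 2 ≤ G :=
      setIntegral_mono_set (h.integrableOn_g_sq hUdom) (Eventually.of_forall fun τ => sq_nonneg _)
        (Eventually.of_forall (Icc_subset_Icc ha.1 hb.2))
    have h3 : b - a ≤ ℓ / 2 ^ (n + 1) := by linarith [length_U_le hℓ n, ha.1, hb.2]
    have h4 : (m b - m a) ^ 2 ≤ ℓ / 2 ^ (n + 1) * G := by
      calc (m b - m a) ^ 2 ≤ (b - a) * ∫ τ in Icc a b, g τ ^ 2 := h1
        _ ≤ ℓ / 2 ^ (n + 1) * G :=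
            mul_le_mul h3 h2 (integral_nonneg fun t => sq_nonneg _) (by positivity)
    have h5 : G ≤ 2 ^ (n + 7) * diss ℓ g q n / Qlo n := by
      rw [le_div_iff₀ hQlo]
      have e : (2 ^ (n + 7))⁻¹ * Qlo n * G * 2 ^ (n + 7) = G * Qlo n := by field_simp
      nlinarith [hD, pow_pos (two_pos (α := ℝ)) (n + 7)]
    calc Qlo n * (m b - m a) ^ 2 ≤ Qlo n * (ℓ / 2 ^ (n + 1) * G) := by gcongr
      _ ≤ Qlo n * (ℓ / 2 ^ (n + 1) * (2 ^ (n + 7) * diss ℓ g q n / Qlo n)) := by gcongr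
      _ = 64 * ℓ * diss ℓ g q n := by
          field_simp
          ring
  have hsq : Qlo n * (m s - m t) ^ 2 ≤ 64 * ℓ * diss ℓ g q n := by
    rcases le_total s t with hst | hts
    · have := key hs ht hst
      rwa [show (m s - m t) ^ 2 = (m t - m s) ^ 2 by ring]
    · exact key ht hs hts
  have hlhs : (Real.sqrt (Qlo n) * |m s - m t|) ^ 2 = Qlo n * (m s - m t) ^ 2 := by
    rw [mul_pow, Real.sq_sqrt hQlo.le, sq_abs]
  have hrhs : (8 * Real.sqrt ℓ * Real.sqrt (diss ℓ g q n)) ^ 2 = 64 * ℓ * diss ℓ g q n := by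
    rw [mul_pow, mul_pow, Real.sq_sqrt hℓ.le, Real.sq_sqrt hD0]; norm_num
  exact (pow_le_pow_iff_left₀ (by positivity) (by positivity) two_ne_zero).1
    (by rw [hlhs, hrhs]; exact hsq)

/-- **Increments of the quadratic means:** `√Q⁻ₙ |M̄ₙ₊₁ - M̄ₙ| ≤ 8 √ℓ √Dₙ` for `n + 1 ≤ N`.
[folklore] -/
theorem ChainHyp.delta_le (h : ChainHyp ℓ N m g q Qlo Qhi Wtot) {n : ℕ} (hn : n + 1 ≤ N) :
    Real.sqrt (Qlo n) * |bmean ℓ m (n + 1) - bmean ℓ m n| ≤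
      8 * Real.sqrt ℓ * Real.sqrt (diss ℓ g q n) := by
  have hℓ := h.hℓ
  have hn' : n ≤ N := (Nat.le_succ n).trans hn
  have hUdom := U_subset hℓ hn'
  have hQlo := h.hQlo n
  have hsq : 0 < Real.sqrt (Qlo n) := Real.sqrt_pos.2 hQlo
  set osc : ℝ := 8 * Real.sqrt ℓ * Real.sqrt (diss ℓ g q n) / Real.sqrt (Qlo n) with hosc
  have hI' := I_succ_subset_U hℓ n
  have hI := I_subset_U hℓ n
  have habs : |bmean ℓ m (n + 1) - bmean ℓ m n| ≤ osc := by
    refine abs_quadMean_sub_quadMean_le (tlo_lt_thi hℓ (n + 1)) (tlo_lt_thi hℓ n) hI' hI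
      (fun s hs => h.hm0 s (hUdom hs)) (h.integrableOn_m_sq (hI'.trans hUdom))
      (h.integrableOn_m_sq (hI.trans hUdom)) fun s hs t ht => ?_
    rw [hosc, le_div_iff₀ hsq, mul_comm]
    exact h.osc_le hn' hs ht
  calc Real.sqrt (Qlo n) * |bmean ℓ m (n + 1) - bmean ℓ m n| ≤ Real.sqrt (Qlo n) * osc :=
        mul_le_mul_of_nonneg_left habs hsq.le
    _ = 8 * Real.sqrt ℓ * Real.sqrt (diss ℓ g q n) := by rw [hosc]; field_simp

/-- Nonnegativity of the block masses. [folklore] -/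
theorem ChainHyp.mass_nonneg (h : ChainHyp ℓ N m g q Qlo Qhi Wtot) {n : ℕ} (hn : n ≤ N) :
    0 ≤ mass ℓ m q n := by
  have hℓ := h.hℓ
  refine setIntegral_nonneg measurableSet_Icc fun t ht => ?_
  have ht0 : 0 ≤ ℓ⁻¹ * t := mul_nonneg (inv_nonneg.2 hℓ.le) ((tlo_pos hℓ n).le.trans ht.1)
  have hq0 : 0 ≤ q t := (h.hQlo n).le.trans (h.hq n hn t (I_subset_U hℓ n ht)).1
  positivity

/-- Nonnegativity of the block dissipations. [folklore] -/
theorem ChainHyp.diss_nonneg (h : ChainHyp ℓ N m g q Qlo Qhi Wtot) {n : ℕ} (hn : n ≤ N) :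
    0 ≤ diss ℓ g q n := by
  have hℓ := h.hℓ
  refine setIntegral_nonneg measurableSet_Icc fun t ht => ?_
  have ht0 : 0 ≤ ℓ⁻¹ * t := mul_nonneg (inv_nonneg.2 hℓ.le) ((ulo_pos hℓ n).le.trans ht.1)
  have hq0 : 0 ≤ q t := (h.hQlo n).le.trans (h.hq n hn t ht).1
  positivity

/-- `0 ≤ Wtot`. [folklore] -/
theorem ChainHyp.Wtot_nonneg (h : ChainHyp ℓ N m g q Qlo Qhi Wtot) : 0 ≤ Wtot :=
  (h.mass_nonneg (Nat.zero_le N)).trans (h.hW 0 (Nat.zero_le N))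

/-! #### The cubed increments ("(10.22) once and (10.23) twice") -/

/-- **`2⁻ⁱ (√Q⁺ᵢ)³ δᵢ³ ≤ 5·2²⁶ √ℓ √Wtot Dᵢ`** for `i + 1 ≤ N`, where `δᵢ = |M̄ᵢ₊₁ - M̄ᵢ|`: split
`δ³ = δ² · δ`, bound `δ²` by the oscillation and `δ ≤ M̄ᵢ + M̄ᵢ₊₁` by the trivial mass bound
(Tao, p. 33: "From (10.22) (once) and (10.23) (twice) one has
`|wⱼ - w_{p(j)}|³ ≲ c^{0.05}δ⁻¹W^{1/2}rⱼ⁻³∫_{10Bⱼ}|∇ω|²`"). [cite: Tao2011, §10, proof of Thm. 10.1 (p. 33)] -/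
theorem ChainHyp.weight_delta_cube_le (h : ChainHyp ℓ N m g q Qlo Qhi Wtot) {i : ℕ} (hi : i + 1 ≤ N) :
    (2⁻¹ : ℝ) ^ i * Real.sqrt (Qhi i) ^ 3 * |bmean ℓ m (i + 1) - bmean ℓ m i| ^ 3 ≤
      5 * 2 ^ 26 * Real.sqrt ℓ * Real.sqrt Wtot * diss ℓ g q i := by
  have hℓ := h.hℓ
  have hi' : i ≤ N := (Nat.le_succ i).trans hi
  set lam := Real.sqrt ℓ with hlam
  set w := Real.sqrt Wtot with hw
  set p := Real.sqrt (Qlo i) with hp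
  set p' := Real.sqrt (Qlo (i + 1)) with hp'
  set P := Real.sqrt (Qhi i) with hP
  set d := Real.sqrt (diss ℓ g q i) with hd
  set M0 := bmean ℓ m i with hM0
  set M1 := bmean ℓ m (i + 1) with hM1
  set δ := |M1 - M0| with hδ
  have hlam0 : 0 < lam := Real.sqrt_pos.2 hℓ
  have hw0 : 0 ≤ w := Real.sqrt_nonneg _
  have hp0 : 0 < p := Real.sqrt_pos.2 (h.hQlo i)
  have hp'0 : 0 < p' := Real.sqrt_pos.2 (h.hQlo (i + 1))
  have hP0 : 0 ≤ P := Real.sqrt_nonneg _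
  have hd0 : 0 ≤ d := Real.sqrt_nonneg _
  have hM00 : 0 ≤ M0 := quadMean_nonneg _ _ _
  have hM10 : 0 ≤ M1 := quadMean_nonneg _ _ _
  have hδ0 : 0 ≤ δ := abs_nonneg _
  -- the four inputs
  have h1 : p * δ ≤ 8 * lam * d := h.delta_le hi
  have h2 : lam * p * M0 ≤ 2 ^ (i + 5) * w := h.bmean_le hi'
  have h3' : lam * p' * M1 ≤ 2 ^ (i + 1 + 5) * w := h.bmean_le hi
  have hpp' : p ≤ 2 * p' := by
    rw [hp, hp', show (2 : ℝ) = Real.sqrt 4 by rw [show (4 : ℝ) = 2 ^ 2 by norm_num, Real.sqrt_sq zero_le_two],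
      ← Real.sqrt_mul (by norm_num)]
    exact Real.sqrt_le_sqrt (h.hΛ' i)
  have hPp : P ≤ 32 * p := by
    rw [hP, hp, show (32 : ℝ) = Real.sqrt 1024 by
      rw [show (1024 : ℝ) = 32 ^ 2 by norm_num, Real.sqrt_sq (by norm_num)], ← Real.sqrt_mul (by norm_num)]
    exact Real.sqrt_le_sqrt (h.hΛ i)
  have h3 : lam * p * M1 ≤ 2 ^ (i + 7) * w := by
    calc lam * p * M1 ≤ lam * (2 * p') * M1 := by gcongr
      _ = 2 * (lam * p' * M1) := by ring
      _ ≤ 2 * (2 ^ (i + 1 + 5) * w) := by gcongr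
      _ = 2 ^ (i + 7) * w := by ring
  have h4 : δ ≤ M0 + M1 := by
    rw [hδ, abs_le]
    constructor <;> linarith
  -- Step A: `p³ δ³ ≤ 5 · 2ⁱ⁺¹¹ λ w d²`
  have hsum : lam * p * (M0 + M1) ≤ 5 * 2 ^ (i + 5) * w := by
    have : lam * p * (M0 + M1) = lam * p * M0 + lam * p * M1 := by ring
    rw [this]
    calc lam * p * M0 + lam * p * M1 ≤ 2 ^ (i + 5) * w + 2 ^ (i + 7) * w := add_le_add h2 h3
      _ = 5 * 2 ^ (i + 5) * w := by ring
  have hA : p ^ 3 * δ ^ 3 ≤ 5 * 2 ^ (i + 11) * lam * w * d ^ 2 := by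
    have e1 : p ^ 3 * δ ^ 3 = (p * δ) ^ 2 * (p * δ) := by ring
    have hpd : (p * δ) ^ 2 ≤ (8 * lam * d) ^ 2 := pow_le_pow_left₀ (by positivity) h1 2
    have hpδ : p * δ ≤ p * (M0 + M1) := mul_le_mul_of_nonneg_left h4 hp0.le
    have step : p ^ 3 * δ ^ 3 ≤ (8 * lam * d) ^ 2 * (p * (M0 + M1)) := by
      rw [e1]; exact mul_le_mul hpd hpδ (by positivity) (by positivity)
    -- multiply by `lam` and use `hsum`
    have step2 : lam * (p ^ 3 * δ ^ 3) ≤ lam * (5 * 2 ^ (i + 11) * lam * w * d ^ 2) := by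
      calc lam * (p ^ 3 * δ ^ 3) ≤ lam * ((8 * lam * d) ^ 2 * (p * (M0 + M1))) :=
            mul_le_mul_of_nonneg_left step hlam0.le
        _ = 64 * lam ^ 2 * d ^ 2 * (lam * p * (M0 + M1)) := by ring
        _ ≤ 64 * lam ^ 2 * d ^ 2 * (5 * 2 ^ (i + 5) * w) := by gcongr
        _ = lam * (5 * 2 ^ (i + 11) * lam * w * d ^ 2) := by ring
    exact le_of_mul_le_mul_left step2 hlam0
  -- Step B: `P³ ≤ 2¹⁵ p³`
  have hB : P ^ 3 ≤ 2 ^ 15 * p ^ 3 := by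
    calc P ^ 3 ≤ (32 * p) ^ 3 := pow_le_pow_left₀ hP0 hPp 3
      _ = 2 ^ 15 * p ^ 3 := by ring
  -- Step C
  have hdiss : d ^ 2 = diss ℓ g q i := Real.sq_sqrt (h.diss_nonneg hi')
  calc (2⁻¹ : ℝ) ^ i * P ^ 3 * δ ^ 3 ≤ (2⁻¹ : ℝ) ^ i * (2 ^ 15 * p ^ 3) * δ ^ 3 := by gcongr
    _ = (2⁻¹ : ℝ) ^ i * 2 ^ 15 * (p ^ 3 * δ ^ 3) := by ring
    _ ≤ (2⁻¹ : ℝ) ^ i * 2 ^ 15 * (5 * 2 ^ (i + 11) * lam * w * d ^ 2) := by gcongr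
    _ = 5 * 2 ^ 26 * lam * w * d ^ 2 * ((2⁻¹ : ℝ) ^ i * 2 ^ i) := by ring
    _ = 5 * 2 ^ 26 * lam * w * diss ℓ g q i := by
        rw [← mul_pow, inv_mul_cancel₀ (two_ne_zero (α := ℝ)), one_pow, mul_one, hdiss]

/-! #### The chain and the main estimate -/

/-- `(x + y)³ ≤ 4x³ + 4y³` for `x, y ≥ 0`. [folklore] -/
theorem add_pow_three_le_four {x y : ℝ} (hx : 0 ≤ x) (hy : 0 ≤ y) :
    (x + y) ^ 3 ≤ 4 * x ^ 3 + 4 * y ^ 3 := by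
  nlinarith [mul_nonneg (add_nonneg hx hy) (sq_nonneg (x - y))]

/-- **The chain:** `M̄ₙ ≤ M̄₀ + Σ_{i<n} |M̄ᵢ₊₁ - M̄ᵢ|` (telescoping). [folklore] -/
theorem bmean_le_bmean_zero_add_sum (ℓ : ℝ) (m : ℝ → ℝ) (n : ℕ) :
    bmean ℓ m n ≤ bmean ℓ m 0 + ∑ i ∈ range n, |bmean ℓ m (i + 1) - bmean ℓ m i| := by
  have htel := Finset.sum_range_sub (fun i => bmean ℓ m i) n
  have hle : ∑ i ∈ range n, (bmean ℓ m (i + 1) - bmean ℓ m i) ≤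
      ∑ i ∈ range n, |bmean ℓ m (i + 1) - bmean ℓ m i| :=
    sum_le_sum fun i _ => le_abs_self _
  linarith

/-- **The dyadic chaining estimate.** Under `ChainHyp`,
`Σ_{n ≤ N} 4ⁿ Aₙ^{3/2} ≤ C √Wtot (Wtot + ℓ² Σ_{n ≤ N} Dₙ)` with the absolute constant
`C = 27000·2²⁰/7` — the shell form of Tao's bound for "the second term of (y61)",
`c^{-0.1}δ² Σᵢ rᵢ⁴wᵢ³ ≲ c^{-0.15}δ³W^{3/2} + c^{0.05}δ⁻¹W^{1/2}Y₁` (p. 33), in the variables of the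
caller (`k^{3/2} ·` this sum, `k = ℓ⁻¹`, is the displayed right-hand side). [cite: Tao2011, §10, proof of Thm. 10.1 (p. 33, the bound for Σᵢ rᵢ⁴wᵢ³)] -/
theorem ChainHyp.sum_four_pow_mass_rpow_le (h : ChainHyp ℓ N m g q Qlo Qhi Wtot) :
    ∑ n ∈ range (N + 1), 4 ^ n * (mass ℓ m q n * Real.sqrt (mass ℓ m q n)) ≤
      27000 * 2 ^ 20 / 7 * Real.sqrt Wtot *
        (Wtot + ℓ ^ 2 * ∑ n ∈ range (N + 1), diss ℓ g q n) := by
  have hℓ := h.hℓ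
  set lam := Real.sqrt ℓ with hlam
  set w := Real.sqrt Wtot with hw
  have hlam0 : 0 < lam := Real.sqrt_pos.2 hℓ
  have hW0 : 0 ≤ Wtot := h.Wtot_nonneg
  have hw0 : 0 ≤ w := Real.sqrt_nonneg _
  -- the increments, the weights and the chain sums
  set δ : ℕ → ℝ := fun i => |bmean ℓ m (i + 1) - bmean ℓ m i| with hδ
  set θ : ℕ → ℝ := fun n => Real.sqrt (Qhi n) ^ 3 with hθ
  have hδ0 : ∀ i, 0 ≤ δ i := fun i => abs_nonneg _
  have hθ0 : ∀ n, 0 ≤ θ n := fun n => by positivity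
  have hM0 : ∀ n, 0 ≤ bmean ℓ m n := fun n => quadMean_nonneg _ _ _
  -- `θₙ ≤ (27/8) θᵢ` for `i ≤ n`
  have hθmono : ∀ i n, i ≤ n → θ n ≤ 27 / 8 * θ i := by
    intro i n hin
    have h1 : Real.sqrt (Qhi n) ≤ 3 / 2 * Real.sqrt (Qhi i) := by
      have hQ : Qhi n ≤ 2 * Qhi i := h.hβ i n hin
      have h2 : Real.sqrt (Qhi n) ≤ Real.sqrt (2 * Qhi i) := Real.sqrt_le_sqrt hQ
      have h3 : Real.sqrt (2 * Qhi i) ≤ 3 / 2 * Real.sqrt (Qhi i) := by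
        rcases le_or_gt 0 (Qhi i) with hq | hq
        · rw [Real.sqrt_mul (by norm_num : (0:ℝ) ≤ 2)]
          have : Real.sqrt 2 ≤ 3 / 2 := by
            rw [show (3 / 2 : ℝ) = Real.sqrt (9 / 4) by
              rw [show (9 / 4 : ℝ) = (3 / 2) ^ 2 by norm_num, Real.sqrt_sq (by norm_num)]]
            exact Real.sqrt_le_sqrt (by norm_num)
          exact mul_le_mul_of_nonneg_right this (Real.sqrt_nonneg _)
        · rw [Real.sqrt_eq_zero'.2 (by linarith), Real.sqrt_eq_zero'.2 hq.le]; norm_num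
      exact h2.trans h3
    calc θ n = Real.sqrt (Qhi n) ^ 3 := rfl
      _ ≤ (3 / 2 * Real.sqrt (Qhi i)) ^ 3 := pow_le_pow_left₀ (Real.sqrt_nonneg _) h1 3
      _ = 27 / 8 * θ i := by simp only [hθ]; ring
  -- Step 1: termwise bound `4ⁿ Aₙ√Aₙ ≤ (λ³/64) 2⁻ⁿ θₙ M̄ₙ³`
  have step1 : ∀ n ∈ range (N + 1), 4 ^ n * (mass ℓ m q n * Real.sqrt (mass ℓ m q n)) ≤
      lam ^ 3 / 64 * ((2⁻¹ : ℝ) ^ n * θ n * bmean ℓ m n ^ 3) := by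
    intro n hn
    have hn' : n ≤ N := Nat.lt_succ_iff.1 (Finset.mem_range.1 hn)
    have h1 := h.mass_rpow_le hn'
    have h2pos : (0 : ℝ) < 64 * 2 ^ n := by positivity
    rw [show lam ^ 3 / 64 * ((2⁻¹ : ℝ) ^ n * θ n * bmean ℓ m n ^ 3) =
      (lam ^ 3 * θ n * bmean ℓ m n ^ 3) / (64 * 2 ^ n) by
        rw [inv_pow]; field_simp]
    rw [le_div_iff₀ h2pos]
    calc 4 ^ n * (mass ℓ m q n * Real.sqrt (mass ℓ m q n)) * (64 * 2 ^ n)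
        = 64 * 2 ^ n * (4 ^ n * (mass ℓ m q n * Real.sqrt (mass ℓ m q n))) := by ring
      _ ≤ lam ^ 3 * Real.sqrt (Qhi n) ^ 3 * bmean ℓ m n ^ 3 := h1
      _ = lam ^ 3 * θ n * bmean ℓ m n ^ 3 := rfl
  -- Step 2: `M̄ₙ³ ≤ 4 M̄₀³ + 100 cₙ`
  have step2 : ∀ n, bmean ℓ m n ^ 3 ≤ 4 * bmean ℓ m 0 ^ 3 + 100 * chainSum δ n := by
    intro n
    have hc := bmean_le_bmean_zero_add_sum ℓ m n
    have hS0 : 0 ≤ ∑ i ∈ range n, δ i := sum_nonneg fun i _ => hδ0 i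
    have hH := sum_pow_three_le_chainSum hδ0 n
    calc bmean ℓ m n ^ 3 ≤ (bmean ℓ m 0 + ∑ i ∈ range n, δ i) ^ 3 :=
          pow_le_pow_left₀ (hM0 n) hc 3
      _ ≤ 4 * bmean ℓ m 0 ^ 3 + 4 * (∑ i ∈ range n, δ i) ^ 3 := add_pow_three_le_four (hM0 0) hS0
      _ ≤ 4 * bmean ℓ m 0 ^ 3 + 4 * (25 * chainSum δ n) := by gcongr
      _ = 4 * bmean ℓ m 0 ^ 3 + 100 * chainSum δ n := by ring
  -- Step 3: sum of the weights, and the resummation of the chain sums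
  have hgeo2 : ∑ n ∈ range (N + 1), (2⁻¹ : ℝ) ^ n ≤ 2 := by
    have hg := hasSum_geometric_of_lt_one (r := (2⁻¹ : ℝ)) (by norm_num) (by norm_num)
    refine (sum_le_hasSum _ (fun m _ => by positivity) hg).trans (le_of_eq ?_)
    norm_num
  have step3a : ∑ n ∈ range (N + 1), (2⁻¹ : ℝ) ^ n * θ n ≤ 27 / 4 * θ 0 := by
    calc ∑ n ∈ range (N + 1), (2⁻¹ : ℝ) ^ n * θ n
        ≤ ∑ n ∈ range (N + 1), (2⁻¹ : ℝ) ^ n * (27 / 8 * θ 0) :=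
          sum_le_sum fun n _ => mul_le_mul_of_nonneg_left (hθmono 0 n (Nat.zero_le n)) (by positivity)
      _ = 27 / 8 * θ 0 * ∑ n ∈ range (N + 1), (2⁻¹ : ℝ) ^ n := by rw [mul_sum]; exact sum_congr rfl fun n _ => by ring
      _ ≤ 27 / 8 * θ 0 * 2 := mul_le_mul_of_nonneg_left hgeo2 (by positivity [hθ0 0])
      _ = 27 / 4 * θ 0 := by ring
  have step3b : ∑ n ∈ range (N + 1), (2⁻¹ : ℝ) ^ n * θ n * chainSum δ n ≤
      54 / 7 * ∑ i ∈ range N, (2⁻¹ : ℝ) ^ i * θ i * δ i ^ 3 := by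
    have := sum_weight_chainSum_le (b := 27 / 8) hδ0 hθ0 (by norm_num) hθmono N
    refine this.trans (le_of_eq ?_)
    norm_num
  -- Step 4: the cubed increments
  have step4 : ∑ i ∈ range N, (2⁻¹ : ℝ) ^ i * θ i * δ i ^ 3 ≤
      5 * 2 ^ 26 * lam * w * ∑ i ∈ range N, diss ℓ g q i := by
    rw [mul_sum]
    refine sum_le_sum fun i hi => ?_
    exact h.weight_delta_cube_le (Nat.succ_le_of_lt (Finset.mem_range.1 hi))
  -- Step 5: the starting block
  have step5 : lam ^ 3 * θ 0 * bmean ℓ m 0 ^ 3 ≤ 2 ^ 30 * w ^ 3 := by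
    have h1 : lam * Real.sqrt (Qlo 0) * bmean ℓ m 0 ≤ 2 ^ 5 * w := by
      have := h.bmean_le (Nat.zero_le N); simpa using this
    have hPp : Real.sqrt (Qhi 0) ≤ 32 * Real.sqrt (Qlo 0) := by
      rw [show (32 : ℝ) = Real.sqrt 1024 by
        rw [show (1024 : ℝ) = 32 ^ 2 by norm_num, Real.sqrt_sq (by norm_num)],
        ← Real.sqrt_mul (by norm_num)]
      exact Real.sqrt_le_sqrt (h.hΛ 0)
    have h2 : lam * Real.sqrt (Qhi 0) * bmean ℓ m 0 ≤ 2 ^ 10 * w := by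
      calc lam * Real.sqrt (Qhi 0) * bmean ℓ m 0 ≤ lam * (32 * Real.sqrt (Qlo 0)) * bmean ℓ m 0 := by
            gcongr
            exact hM0 0
        _ = 32 * (lam * Real.sqrt (Qlo 0) * bmean ℓ m 0) := by ring
        _ ≤ 32 * (2 ^ 5 * w) := by gcongr
        _ = 2 ^ 10 * w := by ring
    calc lam ^ 3 * θ 0 * bmean ℓ m 0 ^ 3 = (lam * Real.sqrt (Qhi 0) * bmean ℓ m 0) ^ 3 := by
          simp only [hθ]; ring
      _ ≤ (2 ^ 10 * w) ^ 3 := pow_le_pow_left₀ (by positivity [hM0 0]) h2 3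
      _ = 2 ^ 30 * w ^ 3 := by ring
  -- Step 6: assemble
  have hdiss0 : ∀ n ∈ range (N + 1), 0 ≤ diss ℓ g q n := fun n hn =>
    h.diss_nonneg (Nat.lt_succ_iff.1 (Finset.mem_range.1 hn))
  have hsumD : ∑ i ∈ range N, diss ℓ g q i ≤ ∑ n ∈ range (N + 1), diss ℓ g q n := by
    rw [sum_range_succ]
    linarith [hdiss0 N (Finset.self_mem_range_succ N)]
  set SD := ∑ n ∈ range (N + 1), diss ℓ g q n with hSD
  have hSD0 : 0 ≤ SD := sum_nonneg hdiss0
  have hw3 : w ^ 3 = w * Wtot := by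
    rw [pow_succ, hw, Real.sq_sqrt hW0]; ring
  have hlam4 : lam ^ 4 = ℓ ^ 2 := by
    rw [show lam ^ 4 = (lam ^ 2) ^ 2 by ring, hlam, Real.sq_sqrt hℓ.le]
  calc ∑ n ∈ range (N + 1), 4 ^ n * (mass ℓ m q n * Real.sqrt (mass ℓ m q n))
      ≤ ∑ n ∈ range (N + 1), lam ^ 3 / 64 * ((2⁻¹ : ℝ) ^ n * θ n * bmean ℓ m n ^ 3) :=
        sum_le_sum step1
    _ = lam ^ 3 / 64 * ∑ n ∈ range (N + 1), (2⁻¹ : ℝ) ^ n * θ n * bmean ℓ m n ^ 3 := by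
        rw [mul_sum]
    _ ≤ lam ^ 3 / 64 * ∑ n ∈ range (N + 1),
          (2⁻¹ : ℝ) ^ n * θ n * (4 * bmean ℓ m 0 ^ 3 + 100 * chainSum δ n) := by
        gcongr with n hn
        exact step2 n
    _ = lam ^ 3 / 64 * (4 * bmean ℓ m 0 ^ 3 * ∑ n ∈ range (N + 1), (2⁻¹ : ℝ) ^ n * θ n +
          100 * ∑ n ∈ range (N + 1), (2⁻¹ : ℝ) ^ n * θ n * chainSum δ n) := by
        congr 1
        rw [mul_sum, mul_sum, ← sum_add_distrib]
        exact sum_congr rfl fun n _ => by ring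
    _ ≤ lam ^ 3 / 64 * (4 * bmean ℓ m 0 ^ 3 * (27 / 4 * θ 0) +
          100 * (54 / 7 * (5 * 2 ^ 26 * lam * w * ∑ i ∈ range N, diss ℓ g q i))) := by
        gcongr
        · have := hM0 0; positivity
        · exact step3b.trans (by gcongr)
    _ = 27 / 64 * (lam ^ 3 * θ 0 * bmean ℓ m 0 ^ 3) +
          100 * 54 * 5 * 2 ^ 26 / (7 * 64) * lam ^ 4 * w * ∑ i ∈ range N, diss ℓ g q i := by
        ring
    _ ≤ 27 / 64 * (2 ^ 30 * w ^ 3) + 100 * 54 * 5 * 2 ^ 26 / (7 * 64) * lam ^ 4 * w * SD := by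
        gcongr
    _ = 27 * 2 ^ 24 * (w * Wtot) + 27000 * 2 ^ 20 / 7 * (ℓ ^ 2 * w * SD) := by
        rw [hw3, hlam4]; ring
    _ ≤ 27000 * 2 ^ 20 / 7 * (w * Wtot) + 27000 * 2 ^ 20 / 7 * (ℓ ^ 2 * w * SD) := by
        gcongr
        norm_num
    _ = 27000 * 2 ^ 20 / 7 * w * (Wtot + ℓ ^ 2 * SD) := by ring

end Chain

end DyadicChaining

end Literature.Analysis.FluidPDE

end
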